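import Literature.NumberTheory.Sieve.RankinComposedTail
import Summits.Parity.GeneralizedHardyLittlewood.Theorems.PrimeLevelFamEdgeMomentsBeyondDiagonalLayersHeckeReindex
import HarnessLib

/-!
# Route `PrimeLevelFamEdge`, crux K_A `MomentsBeyondDiagonal` (stmt-Parity-20007), line «petersson_layers» v4:
# COUNTING the variables with a LARGE `N`-factored divisor — `#{m ≤ X : ∃ P ∣ m, P N-factored, P > K} ≤ X · K^{−1/2} · 4^{ω(N)}`

In the print band the terms of a regrouped layer form one of whose variables has `(qr)`-part `> K` are bounded by the Parseval
floor (`…LayersBlockFourierBound`), affordable on a short window because such terms are FEW: a variable with `(m, N^∞) > K` has an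
`N`-factored divisor `> K` (its `N`-part), and by the union bound over such divisors `P` and Rankin's trick at `σ = 1/2`
(`RankinComposed.sum_inv_le_rankin`),

  `#{1 ≤ m ≤ X : ∃ P ∣ m, P ∈ factoredNumbers(primeFactors N), P > K} ≤ X · K^{−1/2} · Π_{p∣N}(1 − p^{−1/2})^{−1} ≤ X · K^{−1/2} · 4^{ω(N)}`

(`card_filter_exists_factored_dvd_gt_le`), together with the `ℓ²(box)` consequence for a bounded two-variable table
(`sum_filter_norm_sq_le_of_card`).  (The `1/s`-weighted twin is the tree's `DispersionAssembly.sum_inv_filter_smoothComponent_le`.)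
Proof only (def-free helper toward `stub_farP` / `stub_band`); nothing about any layer, K_A or Landau–Siegel zeros is claimed.
-/

noncomputable section

open Finset
open Literature.NumberTheory.Sieve

namespace Summit.Parity.GeneralizedHardyLittlewood.Theorems.MomentsBeyondDiagonal.Layers

/-- The multiples of `P ≥ 1` in `[1, X]` number `X / P ≤ X/P`. [folklore] -/
theorem card_filter_dvd_Icc_le {P : ℕ} (hP : 0 < P) (X : ℕ) :
    (#((Icc 1 X).filter (fun m ↦ P ∣ m)) : ℝ) ≤ (X : ℝ) / P := by
  rw [filter_dvd_Icc_eq_image hP, Finset.card_image_of_injective _ (fun a b h ↦ Nat.eq_of_mul_eq_mul_left hP h),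
    Nat.card_Icc, Nat.add_sub_cancel]
  exact Nat.cast_div_le

open Classical in
/-- **Few integers have a large `N`-factored divisor** (`K ≥ 1`; any `N`):
`#{1 ≤ m ≤ X : ∃ P ∣ m, P ∈ factoredNumbers(primeFactors N), K < P} ≤ X · K^{−1/2} · 4^{ω(N)}`. [folklore] -/
theorem card_filter_exists_factored_dvd_gt_le (N : ℕ) {K : ℕ} (hK : 1 ≤ K) (X : ℕ) :
    (#((Icc 1 X).filter (fun m : ℕ ↦ ∃ P : ℕ, P ∣ m ∧ P ∈ Nat.factoredNumbers N.primeFactors ∧ K < P)) : ℝ) ≤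
      (X : ℝ) * ((K : ℝ) ^ (-(1 / 2 : ℝ)) * (4 : ℝ) ^ N.primeFactors.card) := by
  set T := (Icc 1 X).filter (fun m : ℕ ↦ ∃ P : ℕ, P ∣ m ∧ P ∈ Nat.factoredNumbers N.primeFactors ∧ K < P) with hT
  set Pset := (Icc 1 X).filter (fun P : ℕ ↦ P ∈ Nat.factoredNumbers N.primeFactors ∧ K < P) with hPset
  -- union bound over the large factored divisor
  have hsub : T ⊆ Pset.biUnion (fun P ↦ (Icc 1 X).filter (fun m ↦ P ∣ m)) := by
    intro m hm
    rw [hT, Finset.mem_filter, Finset.mem_Icc] at hm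
    obtain ⟨⟨hm1, hmX⟩, P, hPm, hPf, hKP⟩ := hm
    rw [Finset.mem_biUnion]
    refine ⟨P, ?_, ?_⟩
    · rw [hPset, Finset.mem_filter, Finset.mem_Icc]
      exact ⟨⟨by omega, (Nat.le_of_dvd (by omega) hPm).trans hmX⟩, hPf, hKP⟩
    · rw [Finset.mem_filter, Finset.mem_Icc]
      exact ⟨⟨hm1, hmX⟩, hPm⟩
  have hcard : (#T : ℝ) ≤ ∑ P ∈ Pset, (X : ℝ) / P := by
    calc (#T : ℝ) ≤ #(Pset.biUnion (fun P ↦ (Icc 1 X).filter (fun m ↦ P ∣ m))) := by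
          exact_mod_cast Finset.card_le_card hsub
      _ ≤ ∑ P ∈ Pset, (#((Icc 1 X).filter (fun m ↦ P ∣ m)) : ℝ) := by
          exact_mod_cast Finset.card_biUnion_le
      _ ≤ ∑ P ∈ Pset, (X : ℝ) / P := Finset.sum_le_sum fun P hP ↦ by
          rw [hPset, Finset.mem_filter, Finset.mem_Icc] at hP
          exact card_filter_dvd_Icc_le hP.1.1 X
  -- Rankin at `σ = 1/2`
  have hprimes : ∀ p ∈ N.primeFactors, p.Prime := fun p hp ↦ Nat.prime_of_mem_primeFactors hp
  have hZ : (0 : ℝ) < (K : ℝ) := by exact_mod_cast hK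
  have hmem : ∀ n ∈ Pset, n ∈ Nat.factoredNumbers N.primeFactors ∧ (K : ℝ) ≤ n := by
    intro n hn
    rw [hPset, Finset.mem_filter] at hn
    exact ⟨hn.2.1, by exact_mod_cast hn.2.2.le⟩
  have hR := RankinComposed.sum_inv_le_rankin hprimes (by norm_num : (0 : ℝ) < 1 / 2) (by norm_num : (1 / 2 : ℝ) ≤ 1) hZ hmem
  have e2 : (-(1 - 1 / 2 : ℝ)) = -(1 / 2 : ℝ) := by norm_num
  rw [e2] at hR
  -- `Π_{p ∣ N} (1 − p^{−1/2})^{−1} ≤ 4^{ω(N)}` (each factor ≤ 4 since `p^{−1/2} ≤ 2^{−1/2} ≤ 3/4`)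
  have hprod : ∏ p ∈ N.primeFactors, (1 - (p : ℝ) ^ (-(1 / 2 : ℝ)))⁻¹ ≤ (4 : ℝ) ^ N.primeFactors.card := by
    rw [← Finset.prod_const]
    have hfac : ∀ p ∈ N.primeFactors, (p : ℝ) ^ (-(1 / 2 : ℝ)) ≤ 3 / 4 := by
      intro p hp
      have hp2 : (2 : ℝ) ≤ p := by exact_mod_cast (Nat.prime_of_mem_primeFactors hp).two_le
      have hp0 : (0 : ℝ) ≤ p := by linarith
      rw [Real.rpow_neg hp0, ← Real.sqrt_eq_rpow]
      have h43 : (4 / 3 : ℝ) ≤ Real.sqrt p := by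
        rw [Real.le_sqrt (by norm_num) hp0]; nlinarith
      rw [inv_le_comm₀ (lt_of_lt_of_le (by norm_num) h43) (by norm_num)]
      linarith
    refine Finset.prod_le_prod (fun p hp ↦ inv_nonneg.mpr (by linarith [hfac p hp])) fun p hp ↦ ?_
    have h := hfac p hp
    rw [inv_le_comm₀ (by linarith) (by norm_num)]
    linarith
  calc (#T : ℝ) ≤ ∑ P ∈ Pset, (X : ℝ) / P := hcard
    _ = (X : ℝ) * ∑ P ∈ Pset, (1 : ℝ) / P := by
        rw [Finset.mul_sum]; exact Finset.sum_congr rfl fun P _ ↦ by ring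
    _ ≤ (X : ℝ) * ((K : ℝ) ^ (-(1 / 2 : ℝ)) * ∏ p ∈ N.primeFactors, (1 - (p : ℝ) ^ (-(1 / 2 : ℝ)))⁻¹) :=
        mul_le_mul_of_nonneg_left hR (Nat.cast_nonneg X)
    _ ≤ (X : ℝ) * ((K : ℝ) ^ (-(1 / 2 : ℝ)) * (4 : ℝ) ^ N.primeFactors.card) :=
        mul_le_mul_of_nonneg_left (mul_le_mul_of_nonneg_left hprod (Real.rpow_nonneg hZ.le _)) (Nat.cast_nonneg X)

/-- **`ℓ²(box)` mass of a bounded table on a thin set of first variables**: if `‖A(m₁,m₂)‖ ≤ c₀` on `[1,X₁]×[1,X₂]` and the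
first variable is restricted to a set `E ⊆ [1, X₁]` with `#E ≤ κ`, then `Σ_{m₁ ∈ E, m₂ ≤ X₂} ‖A‖² ≤ c₀² κ X₂` (used with
`E` = the variables with a large `(qr)`-part, `κ = X₁K^{−1/2}4^{ω}` from `card_filter_exists_factored_dvd_gt_le`). [folklore] -/
theorem sum_filter_norm_sq_le_of_card (X₁ X₂ : ℕ) (E : Finset ℕ) (hE : E ⊆ Icc 1 X₁) {κ : ℝ} (hκ : (#E : ℝ) ≤ κ)
    (A : ℕ → ℕ → ℂ) {c₀ : ℝ} (hA : ∀ m₁ ∈ Icc 1 X₁, ∀ m₂ ∈ Icc 1 X₂, ‖A m₁ m₂‖ ≤ c₀) :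
    ∑ p ∈ E ×ˢ Icc 1 X₂, ‖A p.1 p.2‖ ^ 2 ≤ c₀ ^ 2 * κ * X₂ := by
  have hterm : ∀ p ∈ E ×ˢ Icc 1 X₂, ‖A p.1 p.2‖ ^ 2 ≤ c₀ ^ 2 := by
    intro p hp
    simp only [Finset.mem_product] at hp
    exact pow_le_pow_left₀ (norm_nonneg _) (hA p.1 (hE hp.1) p.2 hp.2) 2
  refine (Finset.sum_le_sum hterm).trans ?_
  rw [Finset.sum_const, Finset.card_product, Nat.card_Icc, nsmul_eq_mul, Nat.add_sub_cancel]
  push_cast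
  have hc0 : 0 ≤ c₀ ^ 2 := sq_nonneg _
  have hX : (0 : ℝ) ≤ X₂ := Nat.cast_nonneg _
  calc (#E : ℝ) * (X₂ : ℝ) * c₀ ^ 2 ≤ κ * (X₂ : ℝ) * c₀ ^ 2 := by gcongr
    _ = c₀ ^ 2 * κ * X₂ := by ring

end Summit.Parity.GeneralizedHardyLittlewood.Theorems.MomentsBeyondDiagonal.Layers

end
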